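/-
Copyright (c) 2026 the pub-hodgecm-mathlib formalisation cell (harness21).  Prover seat hodgecm-mathlib-LH10-p01 (g12): road M6 → F5 → dyadic chain of `stub_DyUnramCore` (D-UNR),
research brick (L2-3)-θ part 3 «THE HERMITIAN CAYLEY SHIFT: FRAME, INVERSE SHIFT, INTEGRALITY, `exp` DRESS — 2-free» (MEMO-L23-θSHIFT v1); 2026-09-03.
-/
import Literature.NumberTheory.Automorphic.TypeTwoHermitianMoebiusShiftValued     -- this seat, part 2: four-scalar invariants, residual units, denominators, dictionary (`|c|^k` currency)
import Literature.NumberTheory.Automorphic.TypeTwoMoebiusShiftValuedGeneric       -- ★ `valued_disc_lt_one_iff_of_valued_lt_one` (`|disc χ_X| < 1 ↔ |disc χ_{1+cX}| < |c|²`)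
import HarnessLib

/-!
# The hermitian Cayley shift of a type-(2) pair, 2-free (part 3): the deep frame from unitarity, the INVERSE shift gains a level, `φ ∘ ψ = id`, the cofactor form and
# integrality of `φg`, the `exp(−1)` dress of the denominators and of the dictionary `(n, N) ↦ (n − 2, N − 1)`, and «no root survives the shift»

Topic `NumberTheory/Automorphic`; namespace `Literature.NumberTheory.Automorphic.MoebiusShift`.  THEOREMS ONLY (no definition, no instance, no notation, no named fact, no `sorry`);
kernel lane `--supports stmt-HodgeConjecture-24833`.  Cell `pub/hodgecm-mathlib` (D-0151), crux H413 = `stmt-HodgeConjecture-24833`; road M6 → F5 → the dyadic chain of organ (D-UNR)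
`stub_DyUnramCore`, LEVEL TWO, site (L2-3) «THE WALL» (FINDING #7); third brick of this seat's θ-shift series (p853610 `MatrixMoebiusShiftHermitian` = the LEVEL lemma; part 2
`TypeTwoHermitianMoebiusShiftValued` = invariants ∕ residual units ∕ denominators ∕ dictionary).  With the pair `(a, b ∣ b′, a′) = (θ, c−θ ∣ c−σθ, σθ)`, `θ + σθ = 1`,
`φ(g) = (θ•g + (c−θ)•1)((c−σθ)•g + σθ•1)⁻¹`, this file supplies the remaining ★ γ₁-shaped heads a port of ★ `shifted_binders_of_typeTwo` ∕ ★ N3 would call, none binding `|2| = 1`: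
* §1 `skew_square_fix_of_unitary_two` — from `g = 1 + c•X ∈ U(σ, J)` and `|disc χ_g| < |c|²`: `tr X` residually skew, `disc χ_X` residually `0`, `det X` residually `σ`-fixed (★ γ₁
  `skew_and_square_of_unitary_two` + part 2 `valued_map_det_sub_det_lt_one_of_unitary_two`; general integral unimodular `J`, `|c|^k` currency);
* §2 THE INVERSE SHIFT `ψ(h) = (σθ•h + (θ−c)•1)((σθ−c)•h + θ•1)⁻¹` GAINS a level — `h ≡ 1 (mod c^j)`, `j ≥ 1` ⇒ `ψ(h), ψ(h)⁻¹ ≡ 1 (mod c^{j+1})` (its denominators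
  `(1−c)•1 + (σθ−c)•F`, `(1−c)•1 + σθ•F` are UNIMODULAR, `N′ − D′ = c•F`) — and `φ(ψ(h)) = h`, `ψ(φ(g)) = g` by ONE four-scalar lemma `genMoebius_inverse_comp`
  (`a N′ + b D′ = (aa′ − bb′)•h`, `b′N′ + a′D′ = (aa′ − bb′)•1`); so `φ : {g ≡ 1 (c^{j+1})} → {h ≡ 1 (c^j)}` (p853610) is ONTO (LH4-p01 (g11)'s «inverse level lemma» remark);
* §3 the cofactor form `φ(1 + c•X) = (1 + θ•X)(1 + (c−σθ)•X)⁻¹`, integrality of `φg` when `|det(1 + (c−σθ)•X)| = 1`, and `|φu| = 1`;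
* §4 the `exp(−1)` dress (`|c| = exp(−1)`): denominators `exp(−2)` ∕ `exp(−1)`, `|disc χ_{φg}| = exp(−(2(N−1)+1))`, `|χ_{φg}(φu)| = exp(−(n−2))` (★ γ₁ §2–§3 minus `h2`);
* §5 `not_exists_isRoot_charpoly_genMoebius` (four scalars; `NeZero 2` is the CHARACTERISTIC of `K`, not a residue condition);
* §6 `valued_map_eq_one_of_add_map_eq_one`: `|σθ| = |θ| = 1` and `|c − σθ| = 1` (`|c| < 1`) — the unit `c − σθ` plays the rôle of ★'s `c − 1` (shifted order, part 4).
HONEST LABEL: count-neutral research brick; no claim on L2-3 beyond the lemmas printed; HC_CM is proved only modulo the 7 printed citations (2 remaining named inputs: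
hLiu418 = stmt-HodgeConjecture-24832, h413 = stmt-HodgeConjecture-24833) until rung 0 closes.

## References
* [Weyl1939] H. Weyl, *The Classical Groups* (1939): Chap. II §10 p. 56.
* [Kottwitz1986BaseChangeUnits] R. E. Kottwitz, *Base change for unit elements of Hecke algebras*, Compositio Math. 60 (1986): §2 pp. 244–247.
* [Rogawski1990] J. D. Rogawski, *Automorphic Representations of Unitary Groups in Three Variables* (1990): §4.9 Prop. 4.9.1 (b) p. 55; §3.5–3.6.
* [Flicker1998UnitaryFL] Y. Z. Flicker, *Elementary proof of the fundamental lemma for a unitary group*, Canad. J. Math. 50 (1998): §6.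
* [HornJohnson2013] R. A. Horn, C. R. Johnson, *Matrix Analysis*, 2nd ed. (2013): §0.8.2.
* [SerreLocalFields1979] J.-P. Serre, *Local Fields*, GTM 67 (1979): Ch. I §§1–2.
-/

set_option autoImplicit false

noncomputable section

open Matrix Polynomial
open scoped WithZero

namespace Literature.NumberTheory.Automorphic.MoebiusShift

section FieldOnly

variable {K : Type*} [Field K] {n : Type*} [Fintype n] [DecidableEq n]

/-! ## §2a `φ ∘ ψ = id` for the inverse pair (any size, any field) -/

/-- **The inverse pair undoes the shift**: for `Δ = a a′ − b b′ ≠ 0` and `ψ(h) = (a′•h − b•1)(−b′•h + a•1)⁻¹` with invertible denominator,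
`(a•ψ(h) + b•1)(b′•ψ(h) + a′•1)⁻¹ = h` (`a N′ + b D′ = Δ•h`, `b′N′ + a′D′ = Δ•1`). [cite: HornJohnson2013, §0.8.2] [cite: Weyl1939, Chap. II §10] -/
theorem genMoebius_inverse_comp (a b a' b' : K) (h : Matrix n n K) (hΔ : a * a' - b * b' ≠ 0) (hD' : IsUnit (-b' • h + a • (1 : Matrix n n K)).det) :
    (a • ((a' • h + -b • (1 : Matrix n n K)) * (-b' • h + a • (1 : Matrix n n K))⁻¹) + b • (1 : Matrix n n K)) *
        (b' • ((a' • h + -b • (1 : Matrix n n K)) * (-b' • h + a • (1 : Matrix n n K))⁻¹) + a' • (1 : Matrix n n K))⁻¹ = h := by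
  set N' : Matrix n n K := a' • h + -b • 1 with hN'
  set D' : Matrix n n K := -b' • h + a • 1 with hD'def
  clear_value N' D'
  have hDD : D' * D'⁻¹ = 1 := Matrix.mul_nonsing_inv _ hD'
  have hnum : a • (N' * D'⁻¹) + b • (1 : Matrix n n K) = ((a * a' - b * b') • h) * D'⁻¹ := by
    have e : a • N' + b • D' = (a * a' - b * b') • h := by rw [hN', hD'def]; module
    calc a • (N' * D'⁻¹) + b • (1 : Matrix n n K) = a • (N' * D'⁻¹) + b • (D' * D'⁻¹) := by rw [hDD]
      _ = (a • N' + b • D') * D'⁻¹ := by rw [add_mul, smul_mul_assoc, smul_mul_assoc]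
      _ = ((a * a' - b * b') • h) * D'⁻¹ := by rw [e]
  have hden : b' • (N' * D'⁻¹) + a' • (1 : Matrix n n K) = (a * a' - b * b') • D'⁻¹ := by
    have e : b' • N' + a' • D' = (a * a' - b * b') • (1 : Matrix n n K) := by rw [hN', hD'def]; module
    calc b' • (N' * D'⁻¹) + a' • (1 : Matrix n n K) = b' • (N' * D'⁻¹) + a' • (D' * D'⁻¹) := by rw [hDD]
      _ = (b' • N' + a' • D') * D'⁻¹ := by rw [add_mul, smul_mul_assoc, smul_mul_assoc]
      _ = (a * a' - b * b') • D'⁻¹ := by rw [e, smul_mul_assoc, Matrix.one_mul]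
  have hinv : ((a * a' - b * b') • D'⁻¹)⁻¹ = (a * a' - b * b')⁻¹ • D' := by
    refine Matrix.inv_eq_right_inv ?_
    rw [smul_mul_assoc, mul_smul_comm, smul_smul, mul_inv_cancel₀ hΔ, one_smul, Matrix.nonsing_inv_mul _ hD']
  rw [hnum, hden, hinv]
  simp only [smul_mul_assoc, mul_smul_comm, smul_smul, inv_mul_cancel₀ hΔ, one_smul, Matrix.mul_assoc, Matrix.nonsing_inv_mul _ hD', Matrix.mul_one]

/-! ## §3a The cofactor form of the hermitian shift at `g = 1 + c•X` -/

/-- **`φ(1 + c•X) = (1 + θ•X)(1 + (c−θ′)•X)⁻¹`** for the pair `(θ, c−θ ∣ c−θ′, θ′)` (`c ≠ 0`, `det(1 + (c−θ′)•X)` a unit): both numerator and denominator are `c` times a cofactor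
(part 2 `smul_one_add_smul_add_smul_one_of_add_eq`; ★ α `moebius_one_add_smul_eq` is the σ-fixed pair). [cite: Kottwitz1986BaseChangeUnits, §2 pp. 244–247] -/
theorem hermitianMoebius_one_add_smul_eq (X : Matrix n n K) {c : K} (hc0 : c ≠ 0) (θ θ' : K) (hD : IsUnit ((1 : Matrix n n K) + (c - θ') • X).det) :
    (θ • ((1 : Matrix n n K) + c • X) + (c - θ) • (1 : Matrix n n K)) * ((c - θ') • ((1 : Matrix n n K) + c • X) + θ' • (1 : Matrix n n K))⁻¹ =
      ((1 : Matrix n n K) + θ • X) * ((1 : Matrix n n K) + (c - θ') • X)⁻¹ := by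
  rw [smul_one_add_smul_add_smul_one_of_add_eq X c θ (c - θ) (by ring), smul_one_add_smul_add_smul_one_of_add_eq X c (c - θ') θ' (by ring)]
  have hinv : (c • ((1 : Matrix n n K) + (c - θ') • X))⁻¹ = c⁻¹ • ((1 : Matrix n n K) + (c - θ') • X)⁻¹ :=
    Matrix.inv_eq_right_inv (by rw [smul_mul_assoc, mul_smul_comm, smul_smul, Matrix.mul_nonsing_inv _ hD, mul_inv_cancel₀ hc0, one_smul])
  rw [hinv, smul_mul_assoc, mul_smul_comm, smul_smul, mul_inv_cancel₀ hc0, one_smul]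

/-! ## §5 No root survives the general shift -/

/-- **`χ_{N D⁻¹}` has no root when `χ_g` has none** (`2 × 2`, four scalars, `a a′ − b b′ ≠ 0`, `det D ≠ 0`, `2 ≠ 0` IN `K`): the discriminants differ by the non-zero square
`((aa′ − bb′)∕det D)²` (part 2 `disc_genMoebius_fin_two`; ★ γ₁ `not_exists_isRoot_charpoly_moebius` is the σ-fixed pair). [cite: Kottwitz1986BaseChangeUnits, §2 pp. 244–247] -/
theorem not_exists_isRoot_charpoly_genMoebius [NeZero (2 : K)] (g : Matrix (Fin 2) (Fin 2) K) (a b a' b' : K) (hD : (b' • g + a' • (1 : Matrix (Fin 2) (Fin 2) K)).det ≠ 0)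
    (hab : a * a' - b * b' ≠ 0) (hirr : ¬ ∃ x : K, g.charpoly.IsRoot x) :
    ¬ ∃ x : K, ((a • g + b • (1 : Matrix (Fin 2) (Fin 2) K)) * (b' • g + a' • (1 : Matrix (Fin 2) (Fin 2) K))⁻¹).charpoly.IsRoot x := by
  rw [exists_isRoot_charpoly_iff_isSquare_disc] at hirr ⊢
  rintro ⟨s, hs⟩
  have key := disc_genMoebius_fin_two g a b a' b' hD
  refine hirr ⟨s * (b' • g + a' • (1 : Matrix (Fin 2) (Fin 2) K)).det / (a * a' - b * b'), ?_⟩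
  field_simp
  linear_combination (b' • g + a' • (1 : Matrix (Fin 2) (Fin 2) K)).det ^ 2 * hs - key

end FieldOnly

section Valued

variable {K : Type*} [Field K] [Valued K ℤᵐ⁰]

/-! ## §1 The deep frame from unitarity: skew trace, square characteristic polynomial, fixed determinant -/

/-- **The frame of `X = c⁻¹(g − 1)`** for `g = 1 + c•X ∈ U(σ, J)` (`X` integral, `J` integral unimodular, `σ` isometric fixing `c`, `0 < |c| < 1`) with `|disc χ_g| < |c|²`:
`|σ(tr X) + tr X| < 1`, `|tr X² − 4 det X| < 1`, `|σ(det X) − det X| < 1` (★ β ∕ ★ `valued_disc_lt_one_iff_of_valued_lt_one` ∕ part 2). [cite: Rogawski1990, §3.5–3.6] -/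
theorem skew_square_fix_of_unitary_two (σ : K →+* K) (hσ : ∀ x, Valued.v (σ x) = Valued.v x)
    {J : Matrix (Fin 2) (Fin 2) K} (hJ : ∀ i j, Valued.v (J i j) ≤ 1) (hJd : Valued.v J.det = 1)
    {c : K} (hc0 : c ≠ 0) (hc : Valued.v c < 1) (hσc : σ c = c) {X : Matrix (Fin 2) (Fin 2) K} (hX : ∀ i j, Valued.v (X i j) ≤ 1)
    (hg : (((1 : Matrix (Fin 2) (Fin 2) K) + c • X).map σ)ᵀ * J * ((1 : Matrix (Fin 2) (Fin 2) K) + c • X) = J)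
    (hdisc : Valued.v (((1 : Matrix (Fin 2) (Fin 2) K) + c • X).trace ^ 2 - 4 * ((1 : Matrix (Fin 2) (Fin 2) K) + c • X).det) < Valued.v c ^ 2) :
    Valued.v (σ X.trace + X.trace) < 1 ∧ Valued.v (X.trace ^ 2 - 4 * X.det) < 1 ∧ Valued.v (σ X.det - X.det) < 1 :=
  ⟨valued_map_trace_add_trace_lt_one_of_unitary σ hσ hJ hJd hc0 hc hσc hX hg, (valued_disc_lt_one_iff_of_valued_lt_one hc0 X).2 hdisc,
    valued_map_det_sub_det_lt_one_of_unitary_two σ hσ hJ hJd hc0 hc hσc hX hg⟩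

/-! ## §2 The inverse shift gains a level -/

/-- `|det((1−c)•1 + t•F)| = 1` and `(·)⁻¹` is integral, for `F` with entries `< 1`, `|t| ≤ 1`, `|c| < 1` (`2 × 2`): the denominators of the inverse shift are unimodular.
[cite: SerreLocalFields1979, Ch. I §§1–2] [cite: HornJohnson2013, §0.8.2] -/
theorem valued_det_and_inv_one_sub_c_add {c t : K} (hc : Valued.v c < 1) (ht : Valued.v t ≤ 1) {F : Matrix (Fin 2) (Fin 2) K} (hF : ∀ a b, Valued.v (F a b) < 1) :
    Valued.v (((1 - c) • (1 : Matrix (Fin 2) (Fin 2) K) + t • F).det) = 1 ∧ ∀ a b, Valued.v ((((1 - c) • (1 : Matrix (Fin 2) (Fin 2) K) + t • F)⁻¹) a b) ≤ 1 := by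
  have h1c : Valued.v (1 - c) = 1 := Valuation.map_one_sub_of_lt _ hc
  have hFle : ∀ a b, Valued.v (F a b) ≤ 1 := fun a b => (hF a b).le
  have ml : ∀ {x z : K}, Valued.v x ≤ 1 → Valued.v z < 1 → Valued.v (x * z) < 1 := fun hx hz => by rw [map_mul]; exact lt_of_le_of_lt (mul_le_of_le_one_left' hx) hz
  have hdet : (((1 - c) • (1 : Matrix (Fin 2) (Fin 2) K) + t • F).det) = (1 - c) ^ 2 + t * ((1 - c) * (F 0 0 + F 1 1) + t * (F 0 0 * F 1 1 - F 0 1 * F 1 0)) := by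
    simp only [Matrix.det_fin_two, Matrix.add_apply, Matrix.smul_apply, Matrix.one_apply_eq, Matrix.one_apply_ne (by decide : (0 : Fin 2) ≠ 1),
      Matrix.one_apply_ne (by decide : (1 : Fin 2) ≠ 0), smul_eq_mul]
    ring
  have hsmall : Valued.v (t * ((1 - c) * (F 0 0 + F 1 1) + t * (F 0 0 * F 1 1 - F 0 1 * F 1 0))) < Valued.v ((1 - c) ^ 2) := by
    rw [map_pow, h1c, one_pow]
    exact ml ht (Valuation.map_add_lt _ (ml h1c.le (Valuation.map_add_lt _ (hF 0 0) (hF 1 1))) (ml ht (Valuation.map_sub_lt _ (ml (hFle 0 0) (hF 1 1)) (ml (hFle 0 1) (hF 1 0)))))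
  have hd1 : Valued.v (((1 - c) • (1 : Matrix (Fin 2) (Fin 2) K) + t • F).det) = 1 := by
    rw [hdet, Valuation.map_add_eq_of_lt_left _ hsmall, map_pow, h1c, one_pow]
  refine ⟨hd1, fun a b => ?_⟩
  have hint : ∀ i j, Valued.v ((((1 - c) • (1 : Matrix (Fin 2) (Fin 2) K) + t • F)) i j) ≤ 1 := fun i j => by
    rw [Matrix.add_apply, Matrix.smul_apply, Matrix.smul_apply, smul_eq_mul, smul_eq_mul]
    refine Valuation.map_add_le _ ?_ (by rw [map_mul]; exact mul_le_one' ht (hFle i j))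
    rw [map_mul]; refine mul_le_one' h1c.le ?_
    rcases eq_or_ne i j with h | h
    · subst h; rw [Matrix.one_apply_eq, map_one]
    · rw [Matrix.one_apply_ne h, map_zero]; exact zero_le_one
  rw [Matrix.inv_def, Ring.inverse_eq_inv', Matrix.smul_apply, smul_eq_mul, map_mul, map_inv₀, hd1, inv_one, one_mul]
  exact valued_adjugate_le_one hint a b

/-- **THE INVERSE SHIFT GAINS A LEVEL**: for `σ`, `θ` integral with `θ + σθ = 1`, `|c| < 1`, `j ≥ 1` and `h ≡ 1 (mod c^j)` entrywise (`2 × 2`):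
`ψ(h) := (σθ•h + (θ−c)•1)((σθ−c)•h + θ•1)⁻¹` satisfies `ψ(h) ≡ 1` and `ψ(h)⁻¹ ≡ 1 (mod c^{j+1})` — with `h = 1 + F`: `N′ = (1−c)•1 + σθ•F`, `D′ = (1−c)•1 + (σθ−c)•F`,
`N′ − D′ = c•F`, and both are unimodular.  Together with p853610 (`φ` loses exactly one level) and `genMoebius_inverse_comp` (`φ∘ψ = id`): `φ` maps the level-`(j+1)`
congruence set ONTO the level-`j` one. [cite: Kottwitz1986BaseChangeUnits, §2 pp. 244–247] [cite: Rogawski1990, §4.9 Prop. 4.9.1 (b) p. 55] -/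
theorem valued_inverseHermitianMoebius_sub_one_le_of_level (σ : K →+* K) (hσ : ∀ x, Valued.v (σ x) = Valued.v x) {θ : K} (hθ : θ + σ θ = 1) (hθv : Valued.v θ ≤ 1)
    {c : K} (hc : Valued.v c < 1) (h : Matrix (Fin 2) (Fin 2) K) {j : ℕ} (hj : 1 ≤ j) (hh : ∀ a b, Valued.v ((h - 1) a b) ≤ Valued.v c ^ j) :
    (∀ a b, Valued.v ((((σ θ • h + (θ - c) • (1 : Matrix (Fin 2) (Fin 2) K)) * ((σ θ - c) • h + θ • (1 : Matrix (Fin 2) (Fin 2) K))⁻¹) - 1) a b) ≤ Valued.v c ^ (j + 1)) ∧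
      ∀ a b, Valued.v ((((σ θ • h + (θ - c) • (1 : Matrix (Fin 2) (Fin 2) K)) * ((σ θ - c) • h + θ • (1 : Matrix (Fin 2) (Fin 2) K))⁻¹)⁻¹ - 1) a b) ≤ Valued.v c ^ (j + 1) := by
  have hσθv : Valued.v (σ θ) ≤ 1 := by rw [hσ]; exact hθv
  set F : Matrix (Fin 2) (Fin 2) K := h - 1 with hF
  have hhF : h = 1 + F := by rw [hF, add_sub_cancel]
  have hcj1 : Valued.v c ^ j < 1 := pow_lt_one₀ zero_le hc (by omega)
  have hFlt : ∀ a b, Valued.v (F a b) < 1 := fun a b => lt_of_le_of_lt (hh a b) hcj1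
  -- numerator and denominator at `h = 1 + F`
  have hN : σ θ • h + (θ - c) • (1 : Matrix (Fin 2) (Fin 2) K) = (1 - c) • (1 : Matrix (Fin 2) (Fin 2) K) + σ θ • F := by
    rw [hhF, smul_add]
    have e : σ θ • (1 : Matrix (Fin 2) (Fin 2) K) + (θ - c) • (1 : Matrix (Fin 2) (Fin 2) K) = (1 - c) • 1 := by
      rw [← add_smul]; congr 1; linear_combination hθ
    rw [add_right_comm, e]
  have hD : (σ θ - c) • h + θ • (1 : Matrix (Fin 2) (Fin 2) K) = (1 - c) • (1 : Matrix (Fin 2) (Fin 2) K) + (σ θ - c) • F := by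
    rw [hhF, smul_add]
    have e : (σ θ - c) • (1 : Matrix (Fin 2) (Fin 2) K) + θ • (1 : Matrix (Fin 2) (Fin 2) K) = (1 - c) • 1 := by
      rw [← add_smul]; congr 1; linear_combination hθ
    rw [add_right_comm, e]
  have hND : ((1 - c) • (1 : Matrix (Fin 2) (Fin 2) K) + σ θ • F) - ((1 - c) • (1 : Matrix (Fin 2) (Fin 2) K) + (σ θ - c) • F) = c • F := by module
  have htD : Valued.v (σ θ - c) ≤ 1 := Valuation.map_sub_le _ hσθv hc.le
  obtain ⟨hDd, hDi⟩ := valued_det_and_inv_one_sub_c_add hc htD hFlt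
  obtain ⟨hNd, hNi⟩ := valued_det_and_inv_one_sub_c_add hc hσθv hFlt
  set N' : Matrix (Fin 2) (Fin 2) K := (1 - c) • (1 : Matrix (Fin 2) (Fin 2) K) + σ θ • F with hN'def
  set D' : Matrix (Fin 2) (Fin 2) K := (1 - c) • (1 : Matrix (Fin 2) (Fin 2) K) + (σ θ - c) • F with hD'def
  have hDu : IsUnit D'.det := isUnit_iff_ne_zero.2 fun h0 => by rw [h0, map_zero] at hDd; exact zero_ne_one hDd
  have hNu : IsUnit N'.det := isUnit_iff_ne_zero.2 fun h0 => by rw [h0, map_zero] at hNd; exact zero_ne_one hNd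
  -- the entry estimate `|(c•F·M) a b| ≤ |c|^{j+1}` for `M` integral
  have est : ∀ (M : Matrix (Fin 2) (Fin 2) K), (∀ a b, Valued.v (M a b) ≤ 1) → ∀ a b, Valued.v ((c • F * M) a b) ≤ Valued.v c ^ (j + 1) := fun M hM a b => by
    rw [Matrix.smul_mul, Matrix.smul_apply, smul_eq_mul, map_mul, pow_succ', Matrix.mul_apply]
    refine mul_le_mul' le_rfl (Valuation.map_sum_le _ fun k _ => ?_)
    rw [map_mul]; exact le_trans (mul_le_mul' (hh a k) (hM k b)) (le_of_eq (mul_one _))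
  rw [hN, hD]
  constructor
  · have e : N' * D'⁻¹ - 1 = c • F * D'⁻¹ := by
      rw [← hND, sub_mul, Matrix.mul_nonsing_inv _ hDu]
    intro a b; rw [e]; exact est _ hDi a b
  · have hinv : (N' * D'⁻¹)⁻¹ = D' * N'⁻¹ := by
      rw [Matrix.mul_inv_rev, Matrix.nonsing_inv_nonsing_inv _ hDu]
    have e : D' * N'⁻¹ - 1 = -(c • F * N'⁻¹) := by
      rw [← hND, sub_mul, Matrix.mul_nonsing_inv _ hNu]; abel
    intro a b; rw [hinv, e, Matrix.neg_apply, Valuation.map_neg]; exact est _ hNi a b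

/-! ## §3 Integrality of the shifted pair -/

/-- **`φg = (1 + θ•X)(1 + t•X)⁻¹` is integral** when `X`, `θ`, `t` are and `det(1 + t•X)` is a unit (★ γ₁ `forall_valued_moebius_le_one` without the `2`).
[cite: Kottwitz1986BaseChangeUnits, §2 pp. 244–247] -/
theorem forall_valued_hermitianMoebius_le_one {m : Type*} [Fintype m] [DecidableEq m] {θ t : K} (hθv : Valued.v θ ≤ 1) (ht : Valued.v t ≤ 1)
    {X : Matrix m m K} (hX : ∀ i j, Valued.v (X i j) ≤ 1) (hD : Valued.v (((1 : Matrix m m K) + t • X).det) = 1) :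
    ∀ i j, Valued.v ((((1 : Matrix m m K) + θ • X) * ((1 : Matrix m m K) + t • X)⁻¹) i j) ≤ 1 := by
  set O : Subring K := (Valued.v : Valuation K ℤᵐ⁰).integer with hOdef
  have hO : ∀ {x : K}, x ∈ O ↔ Valued.v x ≤ 1 := fun {x} => Valuation.mem_integer_iff _ _
  have hX' : ∀ i j, X i j ∈ O := fun i j => hO.2 (hX i j)
  have e : ∀ s : K, (1 : Matrix m m K) + s • X = (1 : K) • (1 : Matrix m m K) + s • X := fun s => by rw [one_smul]
  have hD' : ∃ d ∈ O, d * ((1 : Matrix m m K) + t • X).det = 1 := by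
    have hne : ((1 : Matrix m m K) + t • X).det ≠ 0 := fun h0 => by rw [h0, map_zero] at hD; exact zero_ne_one hD
    exact ⟨_, hO.2 (by rw [map_inv₀, hD, inv_one]), inv_mul_cancel₀ hne⟩
  intro i j
  rw [e θ, e t] at *
  exact hO.1 (forall_mem_mul O (forall_mem_smul_one_add_smul O hX' O.one_mem (hO.2 hθv))
    (forall_mem_inv O (forall_mem_smul_one_add_smul O hX' O.one_mem (hO.2 ht)) hD') i j)

/-- **`φu` is a unit**: `|(θu + (c−θ))∕((c−σθ)u + σθ)| = 1` when both have valuation `|c| ≠ 0` (★ γ₁ `valued_moebius_one_eq_one`). [cite: Kottwitz1986BaseChangeUnits, §2 pp. 244–247] -/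
theorem valued_hermitianMoebius_scalar_eq_one (σ : K →+* K) {θ c u : K} (hc0 : c ≠ 0)
    (hD : Valued.v ((c - σ θ) * u + σ θ) = Valued.v c) (hN : Valued.v (θ * u + (c - θ)) = Valued.v c) :
    Valued.v ((θ * u + (c - θ)) / ((c - σ θ) * u + σ θ)) = 1 := by
  rw [map_div₀, hD, hN, div_self ((Valuation.ne_zero_iff _).2 hc0)]

/-! ## §4 The `exp(−1)` dress: denominators and the dictionary `(n, N) ↦ (n − 2, N − 1)` -/

/-- **The four denominators in `exp` currency**: at `|c| = exp(−1)`, from unitarity alone (part 2 `valued_hermitianShift_denominators_of_unitary`):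
`|det((c−σθ)•g + σθ•1)| = |det(θ•g + (c−θ)•1)| = exp(−2)`, `|(c−σθ)u + σθ| = |θu + (c−θ)| = exp(−1)` (★ γ₁ `valued_det_shift_denominators` ∕ `valued_shift_denominators_one` minus `h2`).
[cite: Kottwitz1986BaseChangeUnits, §2 pp. 244–247] [cite: Rogawski1990, §3.5–3.6] -/
theorem valued_hermitianShift_denominators_of_unitary_of_exp (σ : K →+* K) (hσ : ∀ x, Valued.v (σ x) = Valued.v x) {θ : K} (hθ1 : Valued.v θ ≤ 1) (hθ : θ + σ θ = 1)
    {J : Matrix (Fin 2) (Fin 2) K} (hJ : ∀ i j, Valued.v (J i j) ≤ 1) (hJd : Valued.v J.det = 1)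
    {c : K} (hc : Valued.v c = WithZero.exp (-1 : ℤ)) (hσc : σ c = c)
    {X : Matrix (Fin 2) (Fin 2) K} (hX : ∀ i j, Valued.v (X i j) ≤ 1) (hdisc : Valued.v (X.trace ^ 2 - 4 * X.det) < 1)
    (hg : (((1 : Matrix (Fin 2) (Fin 2) K) + c • X).map σ)ᵀ * J * ((1 : Matrix (Fin 2) (Fin 2) K) + c • X) = J)
    {y : K} (hy : Valued.v y ≤ 1) (hu : σ (1 + c * y) * (1 + c * y) = 1) :
    Valued.v (((c - σ θ) • ((1 : Matrix (Fin 2) (Fin 2) K) + c • X) + σ θ • (1 : Matrix (Fin 2) (Fin 2) K)).det) = WithZero.exp (-2 : ℤ) ∧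
      Valued.v ((θ • ((1 : Matrix (Fin 2) (Fin 2) K) + c • X) + (c - θ) • (1 : Matrix (Fin 2) (Fin 2) K)).det) = WithZero.exp (-2 : ℤ) ∧
      Valued.v ((c - σ θ) * (1 + c * y) + σ θ) = WithZero.exp (-1 : ℤ) ∧ Valued.v (θ * (1 + c * y) + (c - θ)) = WithZero.exp (-1 : ℤ) := by
  obtain ⟨hc0, hc1, -, -, -, -⟩ := shift_parameter_facts hc
  have e2 : Valued.v c ^ 2 = WithZero.exp (-2 : ℤ) := by rw [hc, ← WithZero.exp_nsmul]; norm_num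
  obtain ⟨h1, h2', h3, h4⟩ := valued_hermitianShift_denominators_of_unitary σ hσ hθ1 hθ hJ hJd hc0 hc1 hσc hX hdisc hg hy hu
  exact ⟨e2 ▸ h1, e2 ▸ h2', hc ▸ h3, hc ▸ h4⟩

/-- **`N ↦ N − 1`**: `|disc χ_{φg}| = exp(−(2(N−1)+1))` when `|disc χ_g| = exp(−(2N+1))`, `|det((c−σθ)•g + σθ•1)| = exp(−2)`, `N ≥ 1`, `|c| = exp(−1)`, `θ + σθ = 1`
(part 2 `valued_disc_hermitianMoebius_mul`; ★ γ₁ `valued_disc_moebius` minus `h2`). [cite: Flicker1998UnitaryFL, §6] [cite: Kottwitz1986BaseChangeUnits, §2 pp. 244–247] -/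
theorem valued_disc_hermitianMoebius_of_exp (σ : K →+* K) {θ : K} (hθ : θ + σ θ = 1) {c : K} (hc : Valued.v c = WithZero.exp (-1 : ℤ)) (g : Matrix (Fin 2) (Fin 2) K)
    (hD : Valued.v (((c - σ θ) • g + σ θ • (1 : Matrix (Fin 2) (Fin 2) K)).det) = WithZero.exp (-2 : ℤ)) {N : ℕ} (hN1 : 1 ≤ N)
    (hN : Valued.v (g.trace ^ 2 - 4 * g.det) = WithZero.exp (-((2 * N + 1 : ℕ) : ℤ))) :
    Valued.v (((θ • g + (c - θ) • (1 : Matrix (Fin 2) (Fin 2) K)) * ((c - σ θ) • g + σ θ • (1 : Matrix (Fin 2) (Fin 2) K))⁻¹).trace ^ 2 -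
        4 * ((θ • g + (c - θ) • (1 : Matrix (Fin 2) (Fin 2) K)) * ((c - σ θ) • g + σ θ • (1 : Matrix (Fin 2) (Fin 2) K))⁻¹).det) =
      WithZero.exp (-((2 * (N - 1) + 1 : ℕ) : ℤ)) := by
  obtain ⟨hc0, hc1, -, -, -, -⟩ := shift_parameter_facts hc
  have e2 : Valued.v c ^ 2 = WithZero.exp (-2 : ℤ) := by rw [hc, ← WithZero.exp_nsmul]; norm_num
  have key := valued_disc_hermitianMoebius_mul σ hθ hc0 hc1 g (by rw [hD, e2])
  rw [e2, hN] at key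
  have hne : WithZero.exp (-2 : ℤ) ≠ 0 := WithZero.exp_ne_zero
  rw [← eq_mul_inv_iff_mul_eq₀ hne, ← WithZero.exp_neg, ← WithZero.exp_add] at key
  rw [key, WithZero.exp_inj]
  omega

/-- **`n ↦ n − 2`**: `|χ_{φg}(φu)| = exp(−(n−2))` when `|χ_g(u)| = exp(−n)`, `|det((c−σθ)•g + σθ•1)| = exp(−2)`, `|(c−σθ)u + σθ| = exp(−1)`, `n ≥ 2`, `|c| = exp(−1)`,
`θ + σθ = 1` (part 2 `valued_eval_charpoly_hermitianMoebius_mul`; ★ γ₁ `valued_eval_charpoly_moebius` minus `h2`). [cite: Flicker1998UnitaryFL, §6] [cite: Kottwitz1986BaseChangeUnits, §2 pp. 244–247] -/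
theorem valued_eval_charpoly_hermitianMoebius_of_exp (σ : K →+* K) {θ : K} (hθ : θ + σ θ = 1) {c : K} (hc : Valued.v c = WithZero.exp (-1 : ℤ))
    (g : Matrix (Fin 2) (Fin 2) K) (u : K) (hD : Valued.v (((c - σ θ) • g + σ θ • (1 : Matrix (Fin 2) (Fin 2) K)).det) = WithZero.exp (-2 : ℤ))
    (hu : Valued.v ((c - σ θ) * u + σ θ) = WithZero.exp (-1 : ℤ)) {n : ℕ} (hn2 : 2 ≤ n) (hn : Valued.v (g.charpoly.eval u) = WithZero.exp (-(n : ℤ))) :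
    Valued.v ((((θ • g + (c - θ) • (1 : Matrix (Fin 2) (Fin 2) K)) * ((c - σ θ) • g + σ θ • (1 : Matrix (Fin 2) (Fin 2) K))⁻¹).charpoly.eval
        ((θ * u + (c - θ)) / ((c - σ θ) * u + σ θ)))) = WithZero.exp (-((n - 2 : ℕ) : ℤ)) := by
  obtain ⟨hc0, hc1, -, -, -, -⟩ := shift_parameter_facts hc
  have e2 : Valued.v c ^ 2 = WithZero.exp (-2 : ℤ) := by rw [hc, ← WithZero.exp_nsmul]; norm_num
  have key := valued_eval_charpoly_hermitianMoebius_mul σ hθ hc0 hc1 g u (by rw [hD, e2]) (by rw [hu, hc])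
  rw [e2, hn] at key
  have hne : WithZero.exp (-2 : ℤ) ≠ 0 := WithZero.exp_ne_zero
  rw [← eq_mul_inv_iff_mul_eq₀ hne, ← WithZero.exp_neg, ← WithZero.exp_add] at key
  rw [key, WithZero.exp_inj]
  omega

/-! ## §6 The scalar `c − σθ` is a unit at every residue characteristic -/

/-- **`|σθ| = 1` (and `|θ| = 1`) for `θ` integral with `θ + σθ = 1`, `σ` isometric**: if `|σθ| < 1` then `θ = 1 − σθ ≡ 1`, so `σθ ≡ σ1 = 1`, i.e. `|1| < 1`.  Hence `|c − σθ| = 1` for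
`|c| < 1`: the scalar `c − σθ` of the hermitian shift is a unit — the rôle `c − 1` plays for the σ-fixed pair. [cite: SerreLocalFields1979, Ch. I §§1–2] -/
theorem valued_map_eq_one_of_add_map_eq_one (σ : K →+* K) (hσ : ∀ x, Valued.v (σ x) = Valued.v x) {θ : K} (hθv : Valued.v θ ≤ 1) (hθ : θ + σ θ = 1) :
    Valued.v (σ θ) = 1 ∧ Valued.v θ = 1 ∧ ∀ {c : K}, Valued.v c < 1 → Valued.v (c - σ θ) = 1 := by
  have hσθv : Valued.v (σ θ) ≤ 1 := by rw [hσ]; exact hθv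
  have key : ∀ {x : K}, x + σ x = 1 → Valued.v (σ x) < 1 → False := fun {x} hx hlt => by
    -- `x = 1 − σx`, so `σx = 1 − σσx` and `|σσx| = |σx| < 1`: `|σx| = |1 − σσx| = 1`
    have e : σ x = 1 - σ (σ x) := by
      have h := congrArg σ hx; rw [map_add, map_one] at h; linear_combination h
    have h1 : Valued.v (σ x) = 1 := by rw [e]; exact Valuation.map_one_sub_of_lt _ (by rw [hσ]; exact hlt)
    rw [h1] at hlt; exact lt_irrefl _ hlt
  have h1 : Valued.v (σ θ) = 1 := hσθv.lt_or_eq.resolve_left fun h => key hθ h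
  have h2 : Valued.v θ = 1 := by
    have hσσ : σ (σ θ) = θ := by
      have h := congrArg σ hθ; rw [map_add, map_one] at h; linear_combination h - hθ
    refine hθv.lt_or_eq.resolve_left fun h => key (x := σ θ) (by rw [hσσ]; linear_combination hθ) (by rw [hσσ]; exact h)
  refine ⟨h1, h2, fun {c} hc => ?_⟩
  rw [sub_eq_add_neg, add_comm, Valuation.map_add_eq_of_lt_left _ (by rw [Valuation.map_neg, h1]; exact hc), Valuation.map_neg, h1]

end Valued

end Literature.NumberTheory.Automorphic.MoebiusShift

end
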